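import Literature.Probability.RandomPlanarGeometry.HexSAWRotSurfaceYcLimitAllY
import Literature.Probability.RandomPlanarGeometry.HexSAWArmchairWallRateSqrtMonotone
import Literature.Probability.RandomPlanarGeometry.HexSAWRotSurfaceYcProp7Riders
import Literature.Probability.RandomPlanarGeometry.HexSAWRotSurfaceYc
import Literature.Probability.RandomPlanarGeometry.HexSAWEndpointKesten
import HarnessLib

/-!
# Beaton 2014, Proposition 7 — EVERY clause, AS PRINTED, for the rotated (armchair) honeycomb surface model, in ONE theorem

Topic `Literature/Probability/RandomPlanarGeometry` (lane «pcv-sawmu», rotated-door lineage; the capstone ASSEMBLY of the door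
`HexSAWRotSurfaceYcLimitAllY.lean` (the limit `C⁺_n(y)^{1/n} → rotSurfaceMu y` and `μ_rot(y) = μ ↔ y ≤ y†`), the rate file
`HexSAWArmchairWallRateSqrtMonotone.lean` (edition ≥ 5: log-convexity / monotonicity / continuity / a.e.-differentiability of
`rotSurfaceMu = max(β_rot, μ)`, door-free), `HexSAWRotSurfaceYcProp7Riders.lean` (`max μ √y ≤ μ_rot(y)` — Prop. 7's
«μ(y) ≥ max{μ, √y}» for the limit; the clause «μ(y) = μ for 0 < y ≤ 1» is read off the door's `rotSurfaceMu_eq_iff` and `1 < y†`),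
`HexSAWRotSurfaceYc.lean` (`hexRotSurfaceYc = y†`, Beaton's Theorem 1) and `HexSAWEndpointKesten.lean` (`μ² = 2 + √2`);
no new mathematics — this file only conjoins tree theorems in the printed order, so that the printed proposition can be cited by ONE name).

Source, verbatim (N. R. Beaton, *The critical surface fugacity of self-avoiding walks on a rotated honeycomb lattice*, J. Phys. A 47 (2014)
075003; arXiv:1210.0274, §3.1, Proposition 7, p. 11 of v3 / corpus TeX chunk 9 ll. 15–32):
"**Proposition 7.** For `y > 0`, `μ(y) := lim_{n→∞} C_n^+(y)^{1/n}` exists and is finite. It is a log-convex, non-decreasing function of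
`log y`, and therefore continuous and almost everywhere differentiable.  For `0 < y ≤ 1`, `μ(y) = μ(1) = μ`, where `μ = √(2+√2)` is the growth
constant of SAWs on the honeycomb lattice. Moreover, for any `y > 0`, `μ(y) ≥ max{μ, √y}`.  This implies the existence of a critical value
`y_c`, with `1 ≤ y_c ≤ μ²`, which delineates the transition from the desorbed phase to the adsorbed phase: `μ(y) = μ` if `y ≤ y_c`, `> μ` if
`y > y_c`."

Dictionary: `μ(y)` = `rotSurfaceMu y` (the VALUE of the limit, `= max (armRate y) μ`), `C_n^+(y)` = `rotHpCoeff n y`, `μ` = `hexConnectiveConstant`,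
`y_c` = `hexRotSurfaceYc` (`= rotYdagger = 2.455…` by Beaton's Theorem 1, tree `HV.hexRotSurfaceYc_eq`).

LABEL: CONSOLIDATION AS PRINTED (assembly; every conjunct is an existing tree theorem — see the proof term).
EDITIONS: ed.1 bf67abdafdd10d44 (a-p6 g12; custody a-idea-2 g27 08:07:00Z, label lit-1 g18 07:37:44Z, ref g48 08:18:48Z; imported
`HexSAWRotSurfaceSqrtUpper` for two conjuncts); ed.2 (this, a-p6 g13) = ed.1 with that import replaced by `HexSAWRotSurfaceYcProp7Riders`
and the two proof lines of clauses (vi)/(viii) re-pointed (door `rotSurfaceMu_eq_iff` + `one_lt_rotYdagger`; `max_le_rotSurfaceMu`) — the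
STATEMENT of `beaton2014_proposition7` is byte-identical; the module no longer waits on G's olean; ed.3 (this, a-p6 g13) = ed.2 with the
`HexSAWRotSurfaceYcBounds` import replaced by `HexSAWRotSurfaceYc` + `HexSAWEndpointKesten` and clause (ix) `1 ≤ y_c ≤ μ²` re-derived
AS BEATON PRINTS IT — from `1 < y†` and from Prop. 7's own bound `√y ≤ μ(y)` at `y = y_c` (where `μ(y_c) = μ`), i.e. `y_c ≤ μ²` —
instead of quoting the sharper numerical bounds of `HexSAWRotSurfaceYcBounds`; statement again byte-identical.
-/

noncomputable section

open Filter
open Literature.Probability.LatticeModels Literature.Probability.Percolation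
open _root_.Topology

namespace Literature.Probability.RandomPlanarGeometry.SAW.HV

open HexBW.Arm

/-- **Beaton 2014, Proposition 7, as printed** (rotated honeycomb surface model; `μ(y) = rotSurfaceMu y`, `y_c = hexRotSurfaceYc`):
(i) for `y > 0` the limit `lim_n C⁺_n(y)^{1/n}` exists, is finite (and positive) and equals `μ(y)`; (ii) `t ↦ log μ(eᵗ)` is convex ("log-convex
function of `log y`"); (iii) `μ` is non-decreasing on `(0,∞)`; (iv) continuous there; (v) almost everywhere differentiable there;
(vi) `μ(y) = μ(1) = μ` for `0 < y ≤ 1`, (vii) where `μ = √(2+√2)`; (viii) `μ(y) ≥ max{μ, √y}` for `y > 0`; (ix) `1 ≤ y_c ≤ μ²`;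
(x) `μ(y) = μ` iff `y ≤ y_c`, and (xi) `μ(y) > μ` iff `y > y_c` (for `y > 0`).
[cite: Beaton2014RotatedHoneycomb, §3.1, Proposition 7 (arXiv v3 p. 11: the full statement quoted in the module header); Theorem 1 (p. 2: y_c = y†); DuminilCopinSmirnov2012, Theorem 1 (μ = √(2+√2))] -/
theorem beaton2014_proposition7 :
    (∀ y : ℝ, 0 < y → ∃ L : ℝ, 0 < L ∧ Tendsto (fun n : ℕ => rotHpCoeff n y ^ ((n : ℝ)⁻¹)) atTop (𝓝 L) ∧ L = rotSurfaceMu y) ∧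
    ConvexOn ℝ Set.univ (fun t : ℝ => Real.log (rotSurfaceMu (Real.exp t))) ∧
    MonotoneOn rotSurfaceMu (Set.Ioi 0) ∧
    ContinuousOn rotSurfaceMu (Set.Ioi 0) ∧
    (∀ᵐ y : ℝ, 0 < y → DifferentiableAt ℝ rotSurfaceMu y) ∧
    (∀ y : ℝ, 0 < y → y ≤ 1 → rotSurfaceMu y = rotSurfaceMu 1 ∧ rotSurfaceMu 1 = hexConnectiveConstant) ∧
    hexConnectiveConstant = Real.sqrt (2 + Real.sqrt 2) ∧
    (∀ y : ℝ, 0 < y → max hexConnectiveConstant (Real.sqrt y) ≤ rotSurfaceMu y) ∧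
    (1 ≤ hexRotSurfaceYc ∧ hexRotSurfaceYc ≤ hexConnectiveConstant ^ 2) ∧
    (∀ y : ℝ, 0 < y → (rotSurfaceMu y = hexConnectiveConstant ↔ y ≤ hexRotSurfaceYc)) ∧
    (∀ y : ℝ, 0 < y → (hexConnectiveConstant < rotSurfaceMu y ↔ hexRotSurfaceYc < y)) := by
  have hμ := hexConnectiveConstant_pos
  have hdpos : 0 < rotYdagger := one_pos.trans one_lt_rotYdagger
  -- «1 ≤ y_c ≤ μ²» exactly as printed: `μ(y_c) = μ` and `√y_c ≤ μ(y_c)` give `y_c = (√y_c)² ≤ μ²`.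
  have hμ2 : hexRotSurfaceYc ≤ hexConnectiveConstant ^ 2 := by
    have h := sqrt_le_rotSurfaceMu hdpos
    rw [(rotSurfaceMu_eq_iff hdpos).2 le_rfl] at h
    rw [hexRotSurfaceYc_eq, ← Real.sq_sqrt hdpos.le]
    exact pow_le_pow_left₀ (Real.sqrt_nonneg _) h 2
  refine ⟨fun y hy => ⟨rotSurfaceMu y, rotSurfaceMu_pos y, tendsto_rotHpCoeff_rpow hy, rfl⟩,
    convexOn_log_rotSurfaceMu_exp, monotoneOn_rotSurfaceMu, continuousOn_rotSurfaceMu, ae_differentiableAt_rotSurfaceMu,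
    fun y hy hy1 => ?_, ?_, fun y hy => ?_, ⟨by rw [hexRotSurfaceYc_eq]; exact one_lt_rotYdagger.le, hμ2⟩, fun y hy => ?_, fun y hy => ?_⟩
  · exact ⟨by rw [(rotSurfaceMu_eq_iff hy).2 (hy1.trans one_lt_rotYdagger.le), (rotSurfaceMu_eq_iff one_pos).2 one_lt_rotYdagger.le],
      (rotSurfaceMu_eq_iff one_pos).2 one_lt_rotYdagger.le⟩
  · rw [← hexConnectiveConstant_sq, Real.sqrt_sq hμ.le]
  · exact max_le_rotSurfaceMu hy
  · rw [hexRotSurfaceYc_eq]; exact rotSurfaceMu_eq_iff hy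
  · rw [hexRotSurfaceYc_eq]; exact hexConnectiveConstant_lt_rotSurfaceMu_iff hy

end Literature.Probability.RandomPlanarGeometry.SAW.HV
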